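import Summits.ResolutionOfSingularities.ResolutionOfSingularities.Theorems.PurelyInseparableDim4PointTreeRational
import Summits.ResolutionOfSingularities.ResolutionOfSingularities.Theorems.PurelyInseparableDim4PointQuadric
import Summits.ResolutionOfSingularities.ResolutionOfSingularities.Theorems.PurelyInseparableDim4IsolationCert
import HarnessLib

/-!
# Purely inseparable four-folds: the rational CERTIFICATE FORMAT is instantiable — the quadric `x₁x₂ + x₃x₄` certified
# over `𝔽₂` resolves `z² + x₁x₂ + x₃x₄` over every algebraically closed field of characteristic `2`
# (brick TY-3k part 12 «QUADRIC CERTIFICATE», cell `res-dim4-pi`)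

[OURS · counted 0] (D-0157 DOOR 2; a worked instance of `Equimultiple.exists_isMarkedResolution_of_rational_certificate`
with every datum over the prime field `𝔽₂ = ZMod 2`; host item stmt-ResolutionOfSingularities-16155, helper). Resolution
of singularities in dimension ≥ 4 / characteristic `p` is NOT proved here or anywhere in this programme; the resolved
object is one quadric cone (classical), the point is the FORMAT.

The certificate (all over `𝔽₂`): root witnesses `g_i = x` (since `x_i = ∂_{i'} F ∈ J₂⁺(F)`, `J₂⁺ = ⟨∂F⟩` at `q = 2`,
tree `IsolationCert.singLocusIdeal_two`), split trivially (only root `0`); the only root parameter is `b = 0`; the root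
state `(F, 0, ∅)` has no `𝔽₂`-edge (indeed no edge at all); its chart witnesses are `g_{j,i} = 1` (the chart transform
`x_{j'} + x_a x_c` has `∂_{j'} = 1`, so `J₂⁺(F′_j) = (1)`), split vacuously.

* `pderiv_linear_add_mul`, `one_mem_singLocusIdeal_chart_quadric`, `X_mem_singLocusIdeal_quadric` — the memberships;
* **`exists_isMarkedResolution_quadric_of_certificate`** — `∃ X′ π M′, IsMarkedResolution ⟨hypSheaf 2 (x₁x₂ + x₃x₄), [], 2⟩ π M′`
  over every `K = K̄` of characteristic `2`, DERIVED FROM THE `𝔽₂`-CERTIFICATE through the rational form (the same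
  conclusion as `exists_isMarkedResolution_quadric`, by the certificate route).

AI-produced formalisation, weaker than expert review. bears_on: LADDER-RESOLUTION:D157-DOOR2 (res-dim4-pi · TY-3k).
-/

set_option linter.dupNamespace false -- D-0017: single-problem summit path `Summit.<S>.<S>.…` by design

noncomputable section

open MvPolynomial Finset CategoryTheory AlgebraicGeometry Opposite TopologicalSpace

namespace Summit.ResolutionOfSingularities.ResolutionOfSingularities.Theorems.PIDim4

open Literature.AlgebraicGeometry.Resolution
open Literature.AlgebraicGeometry.Resolution.Hauser2010
open Literature.AlgebraicGeometry.Resolution.AffinePointBlowup (P A γ coord Wtop ξ)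

namespace Equimultiple

section QuadricCert

variable {L : Type} [Field L]

/-- `∂_i (x_i + x_a x_c) = 1` for `i ∉ {a, c}`. [folklore] -/
theorem pderiv_linear_add_mul {i a c : Fin 4} (hia : i ≠ a) (hic : i ≠ c) :
    pderiv i (X i + X a * X c : MvPolynomial (Fin 4) L) = 1 := by
  rw [map_add, pderiv_X_self, pderiv_mul, pderiv_X_of_ne hia.symm, pderiv_X_of_ne hic.symm, zero_mul, mul_zero,
    add_zero, add_zero]

/-- **`J₂⁺` of every chart transform of `x₁x₂ + x₃x₄` is the unit ideal** (a linear monomial survives: `∂_{j'} F′_j = 1`).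
[cite: Giraud1975, §1 (Hasse–Schmidt derivations)] -/
theorem one_mem_singLocusIdeal_chart_quadric (j : Fin 4) :
    (1 : MvPolynomial (Fin 4) L) ∈
      singLocusIdeal 2 (CentreBlowup.chartTransform 2 Finset.univ j (X 0 * X 1 + X 2 * X 3 : MvPolynomial (Fin 4) L)) := by
  obtain ⟨i, a, c, hia, hic, hct⟩ := chartTransform_quadric (K := L) j
  rw [hct, IsolationCert.singLocusIdeal_two]
  have h1 := pderiv_linear_add_mul (L := L) hia hic
  rw [← h1]
  exact Ideal.subset_span ⟨i, rfl⟩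

/-- **`x_i ∈ J₂⁺(x₁x₂ + x₃x₄)`** (`x_i = ∂_{i'} F` for the partner `i'`). [cite: Giraud1975, §1 (Hasse–Schmidt derivations)] -/
theorem X_mem_singLocusIdeal_quadric (i : Fin 4) :
    (X i : MvPolynomial (Fin 4) L) ∈ singLocusIdeal 2 (X 0 * X 1 + X 2 * X 3 : MvPolynomial (Fin 4) L) := by
  rw [IsolationCert.singLocusIdeal_two]
  have key : ∀ {i i' a c : Fin 4}, i' ≠ i → i' ≠ a → i' ≠ c →
      (X 0 * X 1 + X 2 * X 3 : MvPolynomial (Fin 4) L) = X i' * X i + X a * X c →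
      (X i : MvPolynomial (Fin 4) L) ∈ Ideal.span (Set.range fun k : Fin 4 =>
        pderiv k (X 0 * X 1 + X 2 * X 3 : MvPolynomial (Fin 4) L)) := by
    intro i i' a c hi hia hic hF
    have h : pderiv i' (X 0 * X 1 + X 2 * X 3 : MvPolynomial (Fin 4) L) = X i := by
      rw [hF, map_add, pderiv_mul, pderiv_mul, pderiv_X_self, pderiv_X_of_ne hi.symm, pderiv_X_of_ne hia.symm,
        pderiv_X_of_ne hic.symm, one_mul, mul_zero, add_zero, zero_mul, mul_zero, add_zero, add_zero]
    rw [← h]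
    exact Ideal.subset_span ⟨i', rfl⟩
  have hj : i = 0 ∨ i = 1 ∨ i = 2 ∨ i = 3 := by fin_cases i <;> simp
  rcases hj with rfl | rfl | rfl | rfl
  · exact key (i' := 1) (a := 2) (c := 3) (by decide) (by decide) (by decide) (by ring)
  · exact key (i' := 0) (a := 2) (c := 3) (by decide) (by decide) (by decide) rfl
  · exact key (i' := 3) (a := 0) (c := 1) (by decide) (by decide) (by decide) (by ring)
  · exact key (i' := 2) (a := 0) (c := 1) (by decide) (by decide) (by decide) (by ring)

/-- **THE QUADRIC RESOLVED BY AN `𝔽₂`-CERTIFICATE.** For every algebraically closed `K` of characteristic `2`,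
`(𝔸⁵_K, (z² + x₁x₂ + x₃x₄)·𝒪, [], 2)` admits a marked resolution — obtained from
`exists_isMarkedResolution_of_rational_certificate` with `L = 𝔽₂`, `f : 𝔽₂ → K` the canonical map, root witnesses
`g_i = x`, the single root parameter `b = 0`, the edge-free root state and chart witnesses `g_{j,i} = 1`: every datum
of the certificate lives over `𝔽₂`. (Same conclusion as `exists_isMarkedResolution_quadric`; the point is the route.)
[cite: BierstoneGrigorievMilmanWlodarczyk2011, Def. 3.1.3] [cite: Hauser2010, §F (equiconstant points)] -/
theorem exists_isMarkedResolution_quadric_of_certificate {K : Type} [Field K] [IsAlgClosed K] [CharP K 2]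
    [DecidableEq K] :
    ∃ (X' : Scheme.{0}) (π : X' ⟶ P 4 K) (M' : MarkedIdeal X'),
      IsMarkedResolution (⟨hypSheaf 2 (X 0 * X 1 + X 2 * X 3 : MvPolynomial (Fin 4) K), [], 2⟩ :
        MarkedIdeal (P 4 K)) π M' := by
  haveI : Fact (Nat.Prime 2) := ⟨Nat.prime_two⟩
  let f : ZMod 2 →+* K := ZMod.castHom (dvd_refl 2) K
  -- the quadric over `K` is the base change of the quadric over `𝔽₂`
  have hmap : MvPolynomial.map f (X 0 * X 1 + X 2 * X 3 : MvPolynomial (Fin 4) (ZMod 2)) =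
      (X 0 * X 1 + X 2 * X 3 : MvPolynomial (Fin 4) K) := by
    simp only [map_add, map_mul, MvPolynomial.map_X]
  rw [← hmap]
  refine exists_isMarkedResolution_of_rational_certificate f (p := 2) _ quadric_ne_zero isClean_quadric
    (fun _ => Polynomial.X) (fun _ => Polynomial.X_ne_zero)
    (fun i => by rw [Polynomial.aeval_X]; exact X_mem_singLocusIdeal_quadric i)
    (fun i x hx => ⟨0, by rw [Polynomial.map_X, Polynomial.eval_X] at hx; rw [hx, map_zero]⟩) fun b hb => ?_
  -- the only root parameter is `b = 0`; its state is `(F, 0, ∅)`, which has no edge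
  obtain rfl := roots_quadric_subset b hb
  have hs : (⟨deletePthPowers 2 (PointBlowup.translate (0 : Fin 4 → ZMod 2) (X 0 * X 1 + X 2 * X 3)), 0, ∅⟩ :
      State (ZMod 2)).F = (X 0 * X 1 + X 2 * X 3 : MvPolynomial (Fin 4) (ZMod 2)) := by
    change deletePthPowers 2 (PointBlowup.translate (0 : Fin 4 → ZMod 2) (X 0 * X 1 + X 2 * X 3)) = _
    rw [PointBlowup.translate_zero]
    exact Literature.Barriers.ResolutionOfSingularities.HauserPerlega.deletePthPowers_eq_self isClean_quadric
  have hno : ∀ s' : State (ZMod 2), ¬ Edge 2 Finset.univ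
      (⟨deletePthPowers 2 (PointBlowup.translate (0 : Fin 4 → ZMod 2) (X 0 * X 1 + X 2 * X 3)), 0, ∅⟩ :
        State (ZMod 2)) s' := by
    rintro s' ⟨j, b, -, -, heq, -, -⟩
    exact not_isEquimultiplePoint_quadric j b _ hs heq
  refine ⟨Acc.intro _ fun s' h => (hno s' h).elim, fun t ht => ?_⟩
  -- the only reachable state is the root; its chart witnesses are the constants `1`
  have ht' : t = ⟨deletePthPowers 2 (PointBlowup.translate (0 : Fin 4 → ZMod 2) (X 0 * X 1 + X 2 * X 3)), 0, ∅⟩ := by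
    induction ht with
    | refl => rfl
    | tail _ hedge ih =>
      subst ih
      exact (hno _ hedge).elim
  subst ht'
  refine ⟨fun _ _ => 1, fun _ _ _ => one_ne_zero, fun j i _ => ?_, fun j i _ x hx => ?_⟩
  · rw [map_one, hs]
    exact Ideal.mem_sup_left (one_mem_singLocusIdeal_chart_quadric j)
  · rw [Polynomial.map_one, Polynomial.eval_one] at hx
    exact absurd hx one_ne_zero

end QuadricCert

end Equimultiple

end Summit.ResolutionOfSingularities.ResolutionOfSingularities.Theorems.PIDim4

end
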